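import Summits.QuantumFields.BalabanUV.T4Continuum.Spine.NE3.SupplierB8
import Summits.QuantumFields.BalabanUV.T4Continuum.Spine.NE3.PreSizesOfSizesB8
import HarnessLib

/-!
# T⁴ programme, node NE3 — census R26′, step 2d-β: THE SUPPLIER ON B8's SURFACE FROM THE TWO SUMMED COARSE SIZES OF `φ` — NO (Π-REG) MAJORANT

Cell `pub-balaban-gaps` (YM blitz, track G2, seat `ne3`, unit `pub-balaban-gaps-ne3`; writer prover-pub-balaban-gaps-ne3-g4-0, 2026-08-23), census
`run/shared/lean/pub/pub-balaban-gaps/ne/NE3.md` §4 R26′ ∕ §10 F8.  `SupplierB8Level.decomposedRepT_slicB8_of_landauRepB8Avg₁` (p349354 ✓) reads the (Π-REG) majorant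
`LocalSupMajorant L N (j+1) Z m C` (B11 Thm 1∕Prop 2 regularity TYPE, asserted for nothing) through the local quadratic letter and `preSizes_of_letters`, i.e. ONLY through the two
summed coarse sizes of `φ := QbarIter L (j+1) W Z`.  THIS FILE re-states the supplier with THOSE TWO SIZES AS HYPOTHESES (letters `P`, `Q`):
`M^d·dirSq φ (periodBox N) ≤ P²·(s₁ξ)²·M⁴·dirSq Z F`, `M^d·dirL1 φ (periodBox N) ≤ Q·M²·dirSq Z F` — the outputs of the remainder towers `RemainderTowerB8.sqrt_l2sq_QbarIter_le`,
`RemainderL1FinalB8.dirL1_QbarIter_le_quadratic` (k-free `P`, `Q` at `d = 4`, NO regularity of `Z`) — via `PreSizesOfSizesB8.preSizes_of_coarseSizes`; the local quadratic letter,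
its regime (`α₀`, (52), `hsmall`, `c₃`) and the level-`(j+1)` unitarity are no longer needed here.  Otherwise VERBATIM (`C₂·C ↦ P`, `C₂·C² ↦ Q` in the sizes).

CONTENT ([folklore]; 0 sorry; no `def`): **`decomposedRepT_slicB8_of_landauRepB8Avg_sizes`**.

HONEST FRAMING.  Bookkeeping over landed kernel theorems; the shape `LandauRepB8Avg`, the normal part's letters, the two coarse sizes and the numeric lines are HYPOTHESES; nothing
about Bałaban's minimisers is proved; **NE3 is NOT proved**; spine PROVED 0∕9; finite T⁴ rung (B)+1 — NOT continuum YM on ℝ⁴, NOT infinite volume, NOT mass gap, NOT `BetaPertH`,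
NOT Clay.  PLACEMENT: `Summits/QuantumFields/BalabanUV/T4Continuum/Spine/NE3/`; imports accepted modules only; moves nothing.
-/

set_option autoImplicit false

open scoped BigOperators Matrix.Norms.L2Operator
open NormedSpace Finset

namespace Summit.QuantumFields.BalabanUV.T4Continuum.NE3.SupplierB8LevelSizes

open Set
open Literature.MathematicalPhysics.QuantumFieldTheory.Balaban1983to89
open B7Prop1Explicit B7Prop2Explicit B7Prop3Flat MatrixLog
open T4AveragingDeficitWall (IsSkewDir IsUnitaryCfg SmallField vary curl curlSq dirSq dirL1 fhol Ad)
open T4AveragingDeficitWallBoundary (IsPeriodicCfg periodBox)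
open AveragingDeficitPeriodicCounting (IsPeriodicDir)
open AveragingDeficitChartCalculus (cavg)
open AveragingDeficitMultiLevelPrep (cavgIter LevelSmall)
open BlockAverageVaryDisc (rho0 rho0_pos)
open BlockAveragePushDirGauge (gaugeDir)
open MinimalActionLevels (perWin)
open MinimalActionSandwich (admissible)
open NE3EnergyShapes (IsUnitarySite IsPeriodicSite)
open NE3CovariantCalculus (hsR hsR_sub_left)
open NE3TangentCovariantTower (QbarIter)
open NE3CovariantLineSumsTower (QbarIter_add)
open NE3SmoothRightInverseW (QbarIter_smul)
open NE3LinearisedAverageSup (curvSum)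
open NE3EnergyWeightedShapes (energyNormW energyNormW_nonneg)
open NE3ProductPath (pathΓ prodM prodM_zero skewHalf skewHalf_eq_self)
open NE3ProductPathBounds (energyNormW_le_of_pointwise energyNormW_add_le sum_norm_curl_le_dirL1 curl_add_dir)
open NE3ProductPathChartSlice (DecomposedRepT)
open NE3ProductPathPlaquettes (small_of_residual_data_poly)
open AveragingDeficitDerivCore (dirL1_nonneg)
open NE3EnergyHessCont (perWin_eq_plaqsOf)
open NE3CurlPairedResidualSpread (dirL1_le_of_pointwise)
open NE3ResidualSliceRep (normalPart normalPart_apply norm_normalPart_sub_le norm_normalPart_le normalPart_skew exp_normalPart_mul_exp_neg)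
open NE3DecomposedRepOfLinearNormalPart (sum_norm_curl_normalPart_le)
open NE3.PreSizesOfSizesB8 (preSizes_of_coarseSizes)
open NE3.PairLandauB8 (avgKernelGauges IsLandauB8 LandauRepB8)
open NE3.PairLandauB8Avg (LandauRepB8Avg slicB8 mem_slicB8_iff skew_of_mem_slicB8 periodic_of_mem_slicB8)
open NE3.DecomposedRepTSlicB8 (decomposedRepT_slicB8_of_linearNormalPart)
open NE3.SupplierB8 (sub_mem_slicB8 pathΓ_normalPart_zero)
open AveragingDeficitTransport (norm_Ad_of_unitary)

noncomputable section

variable {d : ℕ} {n : Type*} [Fintype n] [DecidableEq n]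

/-! ## The supplier from the two summed coarse sizes -/

/-- **THE CHART SUPPLIER ON B8's SURFACE FROM THE TWO SUMMED COARSE SIZES OF `φ`** (no (Π-REG) majorant, no local quadratic letter): from `LandauRepB8Avg`, a Landau linear
normal part with its letters (R1)–(R4) against `φ := QbarIter L (j+1) W Z`, the two coarse sizes `M^d·dirSq φ ≤ P²(s₁ξ)²M⁴·dirSq Z F`, `M^d·dirL1 φ ≤ Q·M²·dirSq Z F` and the k-free
lines — `DecomposedRepT … (slicB8 …) … ∧ pathΓ X N 0 = Z`, sizes with `C₂C ↦ P`, `C₂C² ↦ Q`. [folklore] -/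
theorem decomposedRepT_slicB8_of_landauRepB8Avg_sizes [Nonempty n] {𝒞 : ℕ → _root_.Set (Site d → Fin d → (Matrix n n ℂ)ˣ)} {L N : ℕ} [NeZero N]
    (hL : 2 ≤ L) (hN : 1 ≤ N) (j : ℕ) {V UA UB : Site d → Fin d → (Matrix n n ℂ)ˣ} {x : ℝ}
    -- the class at the background
    (hWu : IsUnitaryCfg (cavg L UB))
    (hx : 0 ≤ x) (hsm : LevelSmall d L j x) (hWx : SmallField (cavg L UB) x)
    (admW : cavg L UB ∈ admissible 𝒞 L (j + 1) V)
    -- the B8 representative with (1.37)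
    {u : Site d → (Matrix n n ℂ)ˣ} {Z : Site d → Fin d → Matrix n n ℂ} {s₁ s₂ β : ℝ}
    (h : LandauRepB8Avg L N (j + 1) (cavg L UB) UA u Z s₁ s₂ β) (hs₁ : 0 ≤ s₁) (hα₀ : s₁ * ((L : ℝ)⁻¹) ^ (j + 1) ≤ 1 / 100)
    -- the two summed coarse sizes of `φ := QbarIter L (j+1) W Z` [supplied by the remainder towers]
    {P Q : ℝ} (hP0 : 0 ≤ P) (hQ0 : 0 ≤ Q)
    (hφ2 : ((L : ℝ) ^ (j + 1)) ^ d * dirSq (QbarIter L (j + 1) (cavg L UB) Z) (periodBox (d := d) N)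
      ≤ P ^ 2 * (s₁ * ((L : ℝ)⁻¹) ^ (j + 1)) ^ 2 * ((L : ℝ) ^ (j + 1)) ^ 4 * dirSq Z (periodBox (d := d) (N * L ^ (j + 1))))
    (hφ1 : ((L : ℝ) ^ (j + 1)) ^ d * dirL1 (QbarIter L (j + 1) (cavg L UB) Z) (periodBox (d := d) N)
      ≤ Q * ((L : ℝ) ^ (j + 1)) ^ 2 * dirSq Z (periodBox (d := d) (N * L ^ (j + 1))))
    -- the Landau linear normal part and its letters against `φ := QbarIter L (j+1) W Z`
    {Nn : Site d → Fin d → Matrix n n ℂ} {αN aN c₁ c₂ c₃ c₄ : ℝ} (hNs : IsSkewDir Nn) (hNP : IsPeriodicDir Nn ((N * L ^ (j + 1) : ℕ) : ℤ))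
    (hNL : IsLandauB8 (d := d) L N (j + 1) (cavg L UB) Nn) (hQ : QbarIter L (j + 1) (cavg L UB) Nn = QbarIter L (j + 1) (cavg L UB) Z)
    (hαN0 : 0 ≤ αN) (hNsup : ∀ (y : Site d) (μ : Fin d), ‖Nn y μ‖ ≤ αN)
    (hαN : αN ≤ 1 / 2700) (hJ1 : (s₁ * ((L : ℝ)⁻¹) ^ (j + 1) + 43 * αN) * (L : ℝ) ^ (j + 1) ≤ 1)
    (haN : ∀ p ∈ perWin d (N * L ^ (j + 1)), ‖curl (cavg L UB) Nn p‖ ≤ aN) (haN0 : 0 ≤ aN)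
    (hc₁ : 0 ≤ c₁) (hc₂ : 0 ≤ c₂) (hc₃' : 0 ≤ c₃) (hc₄ : 0 ≤ c₄)
    (hR1 : dirSq Nn (periodBox (d := d) (N * L ^ (j + 1)))
      ≤ c₁ * (((L : ℝ) ^ (j + 1)) ^ d / ((L : ℝ) ^ (j + 1)) ^ 2) * dirSq (QbarIter L (j + 1) (cavg L UB) Z) (periodBox (d := d) N))
    (hR2 : curlSq (cavg L UB) Nn (periodBox (d := d) (N * L ^ (j + 1)))
      ≤ c₂ * (((L : ℝ) ^ (j + 1)) ^ d / ((L : ℝ) ^ (j + 1)) ^ 4) * dirSq (QbarIter L (j + 1) (cavg L UB) Z) (periodBox (d := d) N))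
    (hR3 : ∑ p ∈ perWin d (N * L ^ (j + 1)), ‖curl (cavg L UB) Nn p‖
      ≤ c₃ * (((L : ℝ) ^ (j + 1)) ^ d / ((L : ℝ) ^ (j + 1)) ^ 2) * dirL1 (QbarIter L (j + 1) (cavg L UB) Z) (periodBox (d := d) N))
    (hR4 : dirL1 Nn (periodBox (d := d) (N * L ^ (j + 1)))
      ≤ c₄ * (((L : ℝ) ^ (j + 1)) ^ d / (L : ℝ) ^ (j + 1)) * dirL1 (QbarIter L (j + 1) (cavg L UB) Z) (periodBox (d := d) N))
    -- the smallness of the ν-letter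
    (hρ : 2 * (c₁ + c₂) * P ^ 2 * s₁ ^ 2 ≤ 1 / 2)
    -- window radii of `W` and of `U_A^u = W·e^{Z}`
    {xW xA : ℝ} (hxW0 : 0 ≤ xW) (hxA0 : 0 ≤ xA)
    (hxW : ∀ p ∈ perWin d (N * L ^ (j + 1)), ‖((fhol (cavg L UB) p : (Matrix n n ℂ)ˣ) : Matrix n n ℂ) - 1‖ ≤ xW)
    (hxA : ∀ p ∈ perWin d (N * L ^ (j + 1)), ‖((fhol (vary (cavg L UB) Z 1) p : (Matrix n n ℂ)ˣ) : Matrix n n ℂ) - 1‖ ≤ xA) :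
    DecomposedRepT 𝒞 L N (j + 1) V UA UB u (fun y μ => Nn y μ - Z y μ) (normalPart Z fun y μ => Nn y μ - Z y μ)
        (slicB8 (d := d) (n := n) L N (j + 1) (cavg L UB))
        (s₁ * ((L : ℝ)⁻¹) ^ (j + 1) + αN) ((1 + 2048 * (s₁ * ((L : ℝ)⁻¹) ^ (j + 1) + αN)) * αN)
        ((1 + 2048 * Real.sqrt (16 * d + 1))
          * (2 * Real.sqrt (c₁ + c₂) * P * s₁))
        (4 * c₃ * Q
            * ((2 * xW + xA + 2 * aN + 4 * (2048 * (s₁ * ((L : ℝ)⁻¹) ^ (j + 1) + αN) * αN) + 48 * (s₁ * ((L : ℝ)⁻¹) ^ (j + 1)) ^ 2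
                + 1300 * ((s₁ * ((L : ℝ)⁻¹) ^ (j + 1) + αN) + (1 + 2048 * (s₁ * ((L : ℝ)⁻¹) ^ (j + 1) + αN)) * αN) ^ 2) * ((L : ℝ) ^ (j + 1)) ^ 2)
          + 8192 * d * (4 * c₄ * Q
            * ((2 * xW + xA + 2 * aN + 4 * (2048 * (s₁ * ((L : ℝ)⁻¹) ^ (j + 1) + αN) * αN) + 48 * (s₁ * ((L : ℝ)⁻¹) ^ (j + 1)) ^ 2
                + 1300 * ((s₁ * ((L : ℝ)⁻¹) ^ (j + 1) + αN) + (1 + 2048 * (s₁ * ((L : ℝ)⁻¹) ^ (j + 1) + αN)) * αN) ^ 2) * ((L : ℝ) ^ (j + 1)) ^ 2)))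
        (1806 * (4 * c₄ * Q
            * ((2 * xW + xA + 2 * aN + 4 * (2048 * (s₁ * ((L : ℝ)⁻¹) ^ (j + 1) + αN) * αN) + 48 * (s₁ * ((L : ℝ)⁻¹) ^ (j + 1)) ^ 2
                + 1300 * ((s₁ * ((L : ℝ)⁻¹) ^ (j + 1) + αN) + (1 + 2048 * (s₁ * ((L : ℝ)⁻¹) ^ (j + 1) + αN)) * αN) ^ 2) * ((L : ℝ) ^ (j + 1)) ^ 2)))
        (2 * xW + xA + 2 * aN + 4 * (2048 * (s₁ * ((L : ℝ)⁻¹) ^ (j + 1) + αN) * αN) + 48 * (s₁ * ((L : ℝ)⁻¹) ^ (j + 1)) ^ 2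
          + 1300 * ((s₁ * ((L : ℝ)⁻¹) ^ (j + 1) + αN) + (1 + 2048 * (s₁ * ((L : ℝ)⁻¹) ^ (j + 1) + αN)) * αN) ^ 2)
      ∧ pathΓ (fun y μ => Nn y μ - Z y μ) (normalPart Z fun y μ => Nn y μ - Z y μ) 0 = Z := by
  have hL1 : 1 ≤ L := by omega
  have hL0 : (0 : ℝ) < L := by exact_mod_cast (show 0 < L by omega)
  -- abbreviations as plain reals
  set α₀' : ℝ := s₁ * ((L : ℝ)⁻¹) ^ (j + 1) with hα₀'def
  set a : ℝ := 2 * xW + xA + 2 * aN + 4 * (2048 * (α₀' + αN) * αN) + 48 * α₀' ^ 2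
    + 1300 * ((α₀' + αN) + (1 + 2048 * (α₀' + αN)) * αN) ^ 2 with hadef
  have hξ : α₀' * (L : ℝ) ^ (j + 1) = s₁ := by
    rw [hα₀'def, inv_pow, mul_assoc, inv_mul_cancel₀ (pow_ne_zero _ hL0.ne'), mul_one]
  have hα₀0 : 0 ≤ α₀' := by rw [hα₀'def]; exact mul_nonneg hs₁ (pow_nonneg (inv_nonneg.mpr hL0.le) _)
  have ha0 : 0 ≤ a := by rw [hadef]; positivity
  -- structural data of the tangent datum `X := Nn − Z`
  have htan : (fun y μ => Nn y μ - Z y μ) ∈ slicB8 (d := d) (n := n) L N (j + 1) (cavg L UB) :=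
    sub_mem_slicB8 hL1 j hWu hx hsm hWx h.skew h.per h.landau hNs hNP hNL hQ
  have hXs : IsSkewDir (fun y μ => Nn y μ - Z y μ) := skew_of_mem_slicB8 htan
  -- (2) the pre-sizes of `Nn` from the letters
  have hsL : (α₀' + αN) * (L : ℝ) ^ (j + 1) ≤ 1 := by
    have h1 : α₀' + αN ≤ α₀' + 43 * αN := by linarith
    exact (mul_le_mul_of_nonneg_right h1 (by positivity)).trans hJ1
  have hρ' : 2 * (c₁ + c₂) * P ^ 2 * (α₀' * (L : ℝ) ^ (j + 1)) ^ 2 ≤ 1 / 2 := by rw [hξ]; exact hρ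
  obtain ⟨hN1, hN2, hN3⟩ := preSizes_of_coarseSizes (N := N) hL1 (j + 1) (cavg L UB) (X₀ := Z) (Nn := Nn)
    (φ := QbarIter L (j + 1) (cavg L UB) Z) (P := P) (Q := Q) (a := a)
    hα₀0 hαN0 hP0 hQ0 hc₁ hc₂ hc₃' hc₄ ha0 hφ2 hφ1 hR1 hR2 hR3 hR4 hρ' hsL
  rw [hξ] at hN1
  -- (3) the moving plaquette radius from 3b
  have hs32 : α₀' + αN < 1 / 32 := by linarith
  have hXsup : ∀ y μ, ‖Nn y μ - Z y μ‖ ≤ α₀' + αN := fun y μ =>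
    (norm_sub_le _ _).trans (by rw [add_comm]; exact add_le_add (h.sup y μ) (hNsup y μ))
  have hX32 : ∀ y μ, ‖Nn y μ - Z y μ‖ ≤ 1 / 32 := fun y μ => (hXsup y μ).trans hs32.le
  have hZ32 : ∀ y μ, ‖Z y μ‖ ≤ 1 / 32 := fun y μ => (h.sup y μ).trans (by linarith)
  have hNgs : IsSkewDir (normalPart Z fun y μ => Nn y μ - Z y μ) := normalPart_skew h.skew hXs hZ32 hX32
  have hαN32 : αN < 1 / 32 := by linarith
  have hNgsub : ∀ y μ, ‖normalPart Z (fun y μ => Nn y μ - Z y μ) y μ - Nn y μ‖ ≤ 2048 * (α₀' + αN) * αN := by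
    intro y μ
    have hb := norm_normalPart_sub_le (X₀ := Z) (Nn := Nn) (y := y) (μ := μ) ((hXsup y μ).trans_lt hs32)
      ((hNsup y μ).trans_lt hαN32)
    have h1 : 0 ≤ ‖Nn y μ‖ := norm_nonneg _
    have hs0 : 0 ≤ α₀' + αN := by positivity
    have h2 : ‖Nn y μ - Z y μ‖ * ‖Nn y μ‖ ≤ (α₀' + αN) * αN := mul_le_mul (hXsup y μ) (hNsup y μ) h1 hs0
    have h3 : 2048 * ‖Nn y μ - Z y μ‖ * ‖Nn y μ‖ ≤ 2048 * (α₀' + αN) * αN := by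
      have := mul_le_mul_of_nonneg_left h2 (by norm_num : (0:ℝ) ≤ 2048)
      linarith [this]
    exact hb.trans h3
  have hNgsup : ∀ y μ, ‖normalPart Z (fun y μ => Nn y μ - Z y μ) y μ‖ ≤ (1 + 2048 * (α₀' + αN)) * αN := by
    intro y μ
    calc ‖normalPart Z (fun y μ => Nn y μ - Z y μ) y μ‖
        = ‖(normalPart Z (fun y μ => Nn y μ - Z y μ) y μ - Nn y μ) + Nn y μ‖ := by rw [sub_add_cancel]
      _ ≤ ‖normalPart Z (fun y μ => Nn y μ - Z y μ) y μ - Nn y μ‖ + ‖Nn y μ‖ := norm_add_le _ _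
      _ ≤ 2048 * (α₀' + αN) * αN + αN := add_le_add (hNgsub y μ) (hNsup y μ)
      _ = (1 + 2048 * (α₀' + αN)) * αN := by ring
  have h42 : 1 + 2048 * (α₀' + αN) ≤ 42 := by linarith
  have hαN' : (1 + 2048 * (α₀' + αN)) * αN ≤ 1 / 64 := by
    have hb : (1 + 2048 * (α₀' + αN)) * αN ≤ 42 * αN := mul_le_mul_of_nonneg_right h42 hαN0
    linarith
  have hsmallR : ∀ t ∈ Icc (0:ℝ) 1, ∀ p ∈ perWin d (N * L ^ (j + 1)),
      ‖((fhol (vary (cavg L UB) (pathΓ (fun y μ => Nn y μ - Z y μ) (normalPart Z fun y μ => Nn y μ - Z y μ) t) 1) p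
        : (Matrix n n ℂ)ˣ) : Matrix n n ℂ) - 1‖ ≤ a := by
    intro t ht p hp
    have h3b := small_of_residual_data_poly hWu h.skew hXs hNgs (X₀ := Z) (Nn := Nn) (fun _ _ => rfl) hNgsub h.sup
      (by linarith) hXsup hNgsup hs32.le hαN' (perWin d (N * L ^ (j + 1))) hxW hxA haN ht p hp
    rw [hadef]; exact h3b
  -- (4) file 2 (T-free) and the start of the path
  refine ⟨?_, pathΓ_normalPart_zero h.skew hZ32 hX32⟩
  exact decomposedRepT_slicB8_of_linearNormalPart hL1 hN j hWu admW ⟨h.unitary, h.periodic⟩ h.rep h.skew h.per hα₀0 h.sup htan hα₀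
    hNP hαN0 hNsup hαN hJ1 ha0 hN1 hN2 hN3 hsmallR


end

end Summit.QuantumFields.BalabanUV.T4Continuum.NE3.SupplierB8LevelSizes
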